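import Mathlib
import HarnessLib
import Summits.HubbardSuperconductivity.HubbardSuperconductivity.Theorems.WeakCouplingBCSKlCertB1gTPm03D0125SpeedFloor

/-!
# Route `WeakCouplingBCS` — certificate half of `WcbcsKohnLuttingerB1g` (stmt-HubbardSuperconductivity-0158):
# CHANNEL STATES on the hole pocket of `ε_{−0.3}` (the analytic row (E3) of the `(⅛, −0.3)` record, by proof) and the record's
# conclusions MODULO the `χ₀` sup bound (E2) and the enclosures (E4) ONLY

Cell `gate-hubbard-kl`, seat margin-1 (g18); zero kit.  After `Theorems/WeakCouplingBCSKlCertB1gTPm03D0125SpeedFloor.lean` (p722895, engine row (E1) proved),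
the `(⅛, −0.3)` record's conclusion `KLB1gDominatesTP (-3/10) mub mua gamma` stood MODULO (E2) the sup bound `|χ₀[ε_{−0.3}](k + k′)| ≤ 53/100` on `F × F`,
(E3) the positivity `9/10 ≤ ∫ u_i² dσ` of four table trials, and (E4) `EnclosuresB1gTP (-3/10)`.  Row (E3) only ever served to produce ONE channel
state per symmetry channel (the fifth conjunct of `KLTPAnalytic`); this file proves that conjunct OUTRIGHT, with the elementary witnesses
`1` (`A1g`), `cos k₀ − cos k₁` (`B1g`), `sin k₀ sin k₁` (`B2g`), `sin k₀ sin k₁ (cos k₀ − cos k₁)` (`A2g`), `sin k₀` (`E`) of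
`Literature/MathematicalPhysics/QuantumLattice/KohnLuttingerChannelStates.lean`, so (E3) disappears from the hypotheses:

* §1 an explicit arc of the Fermi curve: for `μ ∈ (−6/5, 0)` and `k₀ ∈ [π/2, 3π/4]` the point `(k₀, arccos g(k₀))`,
  `g = (−μ/2 − cos k₀)/(1 − (3/5)cos k₀) ∈ (0, 1)`, lies on `fermiCurve (squareDispersion 1 (-3/10)) μ` with `k₁ ∈ (0, π/2)` (`kltp_m03_arc_point`);
* §2 its length is `≥ π/4` (`kltp_m03_arc_length`: the first-coordinate projection is `1`-Lipschitz and covers `[π/2, 3π/4]`;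
  `LipschitzWith.hausdorffMeasure_image_le`, `hausdorffMeasure_real`), `‖∇ε_{−0.3}‖ ≤ 5` everywhere (`kltp_m03_speed_le`), and hence — the speed being
  POSITIVE on the Fermi curve by the sharp floor `kltp_m03_speedSq_floor` of p722895 — the Fermi-curve measure of the box `k₀ ∈ [π/2, 3π/4]`, `k₁ ∈ (0, π/2)`
  is `≥ (1/5)(π/4) > 0` for `μ ∈ (−6/5, −4/5]` (`kltp_m03_box_measure_pos`);
* §3 none of the five witnesses vanishes on that box (`sin k₀ > 0`, `sin k₁ > 0`, `cos k₀ ≤ 0 < cos k₁`), so each has positive square integral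
  (`kltp_m03_sq_integral_pos`, `integral_pos_iff_support_of_nonneg`) and **`kltp_m03_channelStates_nonempty`**: every channel has a state,
  `μ ∈ (−6/5, −4/5]`;
* §4 **`kltp_m03_analytic_of_chi0Sup`**: `KLTPAnalytic (squareDispersion 1 (-3/10)) μ` for `μ ∈ (−6/5, −4/5]` from the `χ₀` sup bound ALONE
  (finiteness from the speed floor, `D₄` rows theorems, Hilbert–Schmidt from the bound, channel states from §3), and the cell corollaries
  **`klCertB1gTPm03D0125_dominates_of_chi0Sup`** / **`…_dominatesAt_of_chi0Sup`**: the record's conclusions MODULO (E2) and (E4) only.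

Honest framing: ONE cell `(δ, t′) = (⅛, −3/10)`; `B1g` dominance remains CONDITIONAL on the named numerical hypotheses (E2) (a sup bound on the Lindhard
function of `ε_{−0.3}` on `F × F`) and (E4) (the certified enclosures), neither proved here; `γ = 33811/2²⁰` is the separate-enclosure currency of the
(δ) record, printed BESIDE W3′ DECIDED (`+0.0435`), replacing nothing; nothing about other cells, `K₃`, `U₀`, the window or superconductivity; a
Kohn–Luttinger `O(U²)` channel statement is not ODLRO; nothing here proves superconductivity in the Hubbard model.
References: S. Raghu, S. A. Kivelson, D. J. Scalapino, Phys. Rev. B 81 (2010) 224505, §II (6)–(8), §III (17); L. C. Evans, R. F. Gariepy,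
*Measure Theory and Fine Properties of Functions* (1992), §2.4 (Hausdorff measure under Lipschitz maps).
-/

noncomputable section

-- the tree's namespace `Summit.<Summit>.<Problem>.Theorems` repeats the summit name by design (D-0017)
set_option linter.dupNamespace false

namespace Summit.HubbardSuperconductivity.HubbardSuperconductivity.Theorems

open MeasureTheory Set Real CwKLChiralWindow Literature.MathematicalPhysics.QuantumLattice
open scoped ENNReal NNReal

/-! ### §1 An explicit arc of the hole pocket of `ε_{−0.3}` over `k₀ ∈ [π/2, 3π/4]` -/

/-- On `[π/2, 3π/4]`: `cos x ≤ 0`, `−1 ≤ cos x`, `0 < sin x`. [folklore] -/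
theorem kltp_arc_trig {x : ℝ} (hx : x ∈ Icc (π / 2) (3 * π / 4)) :
    cos x ≤ 0 ∧ -1 ≤ cos x ∧ 0 < sin x := by
  have hπ := Real.pi_pos
  refine ⟨cos_nonpos_of_pi_div_two_le_of_le hx.1 (by linarith [hx.2]), neg_one_le_cos x,
    sin_pos_of_pos_of_lt_pi (by linarith [hx.1]) (by linarith [hx.2])⟩

/-- The ordinate function of the arc: for `μ ∈ (−6/5, 0)` and `cos x ∈ [−1, 0]`, `g = (−μ/2 − cos x)/(1 − (3/5)cos x) ∈ (0, 1)`. [folklore] -/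
theorem kltp_m03_arc_g {μ a : ℝ} (hμ1 : -6 / 5 < μ) (hμ2 : μ < 0) (ha1 : -1 ≤ a) (ha2 : a ≤ 0) :
    0 < (-μ / 2 - a) / (1 + 2 * (-3 / 10 : ℝ) * a) ∧ (-μ / 2 - a) / (1 + 2 * (-3 / 10 : ℝ) * a) < 1 := by
  have hd : 0 < 1 + 2 * (-3 / 10 : ℝ) * a := by linarith
  refine ⟨div_pos (by linarith) hd, ?_⟩
  rw [div_lt_one hd]
  linarith

/-- **The arc lies on the Fermi curve**: for `μ ∈ (−6/5, 0)` and `x ∈ [π/2, 3π/4]`, the point `(x, arccos g(x))` is a point of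
`fermiCurve (squareDispersion 1 (-3/10)) μ` with second coordinate in `(0, π/2)`. [folklore] -/
theorem kltp_m03_arc_point {μ : ℝ} (hμ1 : -6 / 5 < μ) (hμ2 : μ < 0) {x : ℝ} (hx : x ∈ Icc (π / 2) (3 * π / 4)) :
    (WithLp.toLp 2 ![x, arccos ((-μ / 2 - cos x) / (1 + 2 * (-3 / 10 : ℝ) * cos x))] : Momentum) ∈
        fermiCurve (squareDispersion 1 (-3 / 10)) μ ∧
      arccos ((-μ / 2 - cos x) / (1 + 2 * (-3 / 10 : ℝ) * cos x)) ∈ Ioo 0 (π / 2) := by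
  have hπ := Real.pi_pos
  obtain ⟨hc0, hc1, -⟩ := kltp_arc_trig hx
  obtain ⟨hg0, hg1⟩ := kltp_m03_arc_g hμ1 hμ2 hc1 hc0
  set g := (-μ / 2 - cos x) / (1 + 2 * (-3 / 10 : ℝ) * cos x) with hg
  have hd : 0 < 1 + 2 * (-3 / 10 : ℝ) * cos x := by linarith
  have hgd : g * (1 + 2 * (-3 / 10 : ℝ) * cos x) = -μ / 2 - cos x := by
    rw [hg]; exact div_mul_cancel₀ _ hd.ne'
  have hk1 : arccos g ∈ Ioo 0 (π / 2) := ⟨arccos_pos.2 hg1, arccos_lt_pi_div_two.2 hg0⟩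
  refine ⟨⟨?_, ?_⟩, hk1⟩
  · -- in the Brillouin zone
    intro i
    fin_cases i
    · simp only [Fin.zero_eta, Matrix.cons_val_zero]
      exact ⟨by linarith [hx.1], by linarith [hx.2]⟩
    · simp only [Fin.mk_one, Matrix.cons_val_one, Matrix.cons_val_fin_one]
      exact ⟨by linarith [hk1.1], by linarith [hk1.2]⟩
  · -- on the level set
    simp only [squareDispersion, Matrix.cons_val_zero, Matrix.cons_val_one, Matrix.cons_val_fin_one]
    rw [cos_arccos (by linarith) hg1.le]
    linear_combination (-2 : ℝ) * hgd

/-! ### §2 The arc has length at least `π/4`, and positive Fermi-curve measure -/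

/-- The first coordinate is `1`-Lipschitz on momentum space. [folklore] -/
theorem kltp_lipschitz_fst : LipschitzWith 1 (fun k : Momentum => k 0) := by
  refine LipschitzWith.mk_one fun k k' => ?_
  rw [EuclideanSpace.dist_eq, Real.dist_eq]
  have h : |k 0 - k' 0| ^ 2 ≤ ∑ i, dist (k i) (k' i) ^ 2 := by
    rw [Fin.sum_univ_two, Real.dist_eq, Real.dist_eq]
    nlinarith [sq_nonneg (|k 1 - k' 1|)]
  calc |k 0 - k' 0| = Real.sqrt (|k 0 - k' 0| ^ 2) := by rw [Real.sqrt_sq (abs_nonneg _)]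
    _ ≤ Real.sqrt (∑ i, dist (k i) (k' i) ^ 2) := Real.sqrt_le_sqrt h

/-- **Length of the arc**: for `μ ∈ (−6/5, 0)` the part of the Fermi curve of `ε_{−0.3}` in the box `k₀ ∈ [π/2, 3π/4]`, `k₁ ∈ (0, π/2)` has
`μH[1] ≥ π/4` (its first-coordinate projection, a `1`-Lipschitz image, covers `[π/2, 3π/4]`). [folklore] -/
theorem kltp_m03_arc_length {μ : ℝ} (hμ1 : -6 / 5 < μ) (hμ2 : μ < 0) :
    ENNReal.ofReal (π / 4) ≤ μH[1] (fermiCurve (squareDispersion 1 (-3 / 10)) μ ∩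
      {k : Momentum | k 0 ∈ Icc (π / 2) (3 * π / 4) ∧ k 1 ∈ Ioo 0 (π / 2)}) := by
  set S := fermiCurve (squareDispersion 1 (-3 / 10)) μ ∩ {k : Momentum | k 0 ∈ Icc (π / 2) (3 * π / 4) ∧ k 1 ∈ Ioo 0 (π / 2)}
    with hS
  have hcover : Icc (π / 2) (3 * π / 4) ⊆ (fun k : Momentum => k 0) '' S := by
    intro x hx
    obtain ⟨hF, hk1⟩ := kltp_m03_arc_point hμ1 hμ2 hx
    refine ⟨_, ⟨hF, ?_, ?_⟩, ?_⟩
    · simpa only [PiLp.toLp_apply, Matrix.cons_val_zero] using hx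
    · simpa only [PiLp.toLp_apply, Matrix.cons_val_one, Matrix.cons_val_fin_one] using hk1
    · simp only [Matrix.cons_val_zero]
  have h1 : μH[1] (Icc (π / 2) (3 * π / 4)) = ENNReal.ofReal (π / 4) := by
    rw [hausdorffMeasure_real, Real.volume_Icc]
    congr 1; ring
  have h2 : μH[1] ((fun k : Momentum => k 0) '' S) ≤ μH[1] S := by
    have h := kltp_lipschitz_fst.hausdorffMeasure_image_le (d := 1) zero_le_one S
    simpa using h
  calc ENNReal.ofReal (π / 4) = μH[1] (Icc (π / 2) (3 * π / 4)) := h1.symm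
    _ ≤ μH[1] ((fun k : Momentum => k 0) '' S) := measure_mono hcover
    _ ≤ μH[1] S := h2

/-- `‖∇ε_{−0.3}(k)‖ ≤ 5` everywhere. [folklore] -/
theorem kltp_m03_speed_le (k : Momentum) : ‖gradient (squareDispersion 1 (-3 / 10)) k‖ ≤ 5 := by
  have hsq := klph_speed_sq (-3 / 10) k
  have hb : (2 * sin (k 0) * (1 + 2 * (-3 / 10 : ℝ) * cos (k 1))) ^ 2 + (2 * sin (k 1) * (1 + 2 * (-3 / 10 : ℝ) * cos (k 0))) ^ 2 ≤ 25 := by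
    have h0 := sin_sq_le_one (k 0); have h1 := sin_sq_le_one (k 1)
    have c0 := abs_cos_le_one (k 0); have c1 := abs_cos_le_one (k 1)
    rw [abs_le] at c0 c1
    have e0 : (2 * sin (k 0) * (1 + 2 * (-3 / 10 : ℝ) * cos (k 1))) ^ 2 = 4 * sin (k 0) ^ 2 * (1 + 2 * (-3 / 10 : ℝ) * cos (k 1)) ^ 2 := by ring
    have e1 : (2 * sin (k 1) * (1 + 2 * (-3 / 10 : ℝ) * cos (k 0))) ^ 2 = 4 * sin (k 1) ^ 2 * (1 + 2 * (-3 / 10 : ℝ) * cos (k 0)) ^ 2 := by ring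
    have f1 : (1 + 2 * (-3 / 10 : ℝ) * cos (k 1)) ^ 2 ≤ (8 / 5) ^ 2 := by nlinarith
    have f0 : (1 + 2 * (-3 / 10 : ℝ) * cos (k 0)) ^ 2 ≤ (8 / 5) ^ 2 := by nlinarith
    rw [e0, e1]
    nlinarith [sq_nonneg (sin (k 0)), sq_nonneg (sin (k 1)), sq_nonneg (1 + 2 * (-3 / 10 : ℝ) * cos (k 1)),
      sq_nonneg (1 + 2 * (-3 / 10 : ℝ) * cos (k 0)), mul_nonneg (sq_nonneg (sin (k 0))) (sq_nonneg (1 + 2 * (-3 / 10 : ℝ) * cos (k 1)))]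
  nlinarith [norm_nonneg (gradient (squareDispersion 1 (-3 / 10)) k)]

/-- **Positive Fermi-curve measure of the box**: for `μ ∈ (−6/5, −4/5]`, `σ[ε_{−0.3}, μ]` gives the box `k₀ ∈ [π/2, 3π/4]`, `k₁ ∈ (0, π/2)` measure
`≥ (1/5)·(π/4) > 0` (density `‖∇ε‖⁻¹ ≥ 1/5` on the Fermi curve, where the speed is positive by `kltp_m03_speedSq_floor`). [folklore] -/
theorem kltp_m03_box_measure_pos {μ : ℝ} (hμ1 : -6 / 5 < μ) (hμ2 : μ ≤ -4 / 5) :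
    0 < fermiCurveMeasure (squareDispersion 1 (-3 / 10)) μ
      {k : Momentum | k 0 ∈ Icc (π / 2) (3 * π / 4) ∧ k 1 ∈ Ioo 0 (π / 2)} := by
  have hπ := Real.pi_pos
  set ε := squareDispersion 1 (-3 / 10) with hε
  set B := {k : Momentum | k 0 ∈ Icc (π / 2) (3 * π / 4) ∧ k 1 ∈ Ioo 0 (π / 2)} with hB
  have hc0 : Measurable fun k : Momentum => k 0 := (PiLp.continuous_apply 2 (fun _ : Fin 2 => ℝ) 0).measurable
  have hc1 : Measurable fun k : Momentum => k 1 := (PiLp.continuous_apply 2 (fun _ : Fin 2 => ℝ) 1).measurable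
  have hBm : MeasurableSet B := (hc0 measurableSet_Icc).inter (hc1 measurableSet_Ioo)
  have hFm : MeasurableSet (fermiCurve ε μ) := measurableSet_fermiCurve (measurable_squareDispersion 1 (-3 / 10)) μ
  -- density floor on the Fermi curve
  have hdens : ∀ k ∈ fermiCurve ε μ, ENNReal.ofReal (1 / 5) ≤ ENNReal.ofReal (‖gradient ε k‖⁻¹) := by
    intro k hk
    apply ENNReal.ofReal_le_ofReal
    have hfl := kltp_m03_speedSq_floor ⟨hμ1.le, hμ2⟩ hk
    have hpos : 0 < ‖gradient ε k‖ := by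
      have h2 : 0 < ‖gradient ε k‖ ^ 2 := by
        rw [hε, klph_speed_sq]
        nlinarith
      nlinarith [norm_nonneg (gradient ε k)]
    rw [one_div]
    exact inv_anti₀ hpos (kltp_m03_speed_le k)
  unfold fermiCurveMeasure
  rw [withDensity_apply _ hBm, Measure.restrict_restrict hBm]
  have hlow : ENNReal.ofReal (1 / 5) * μH[1] (B ∩ fermiCurve ε μ) ≤
      ∫⁻ k in B ∩ fermiCurve ε μ, ENNReal.ofReal (‖gradient ε k‖⁻¹) ∂(μH[1] : Measure Momentum) := by
    calc ENNReal.ofReal (1 / 5) * μH[1] (B ∩ fermiCurve ε μ)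
        = ∫⁻ _ in B ∩ fermiCurve ε μ, ENNReal.ofReal (1 / 5) ∂(μH[1] : Measure Momentum) := by
          rw [lintegral_const, Measure.restrict_apply MeasurableSet.univ, univ_inter]
      _ ≤ ∫⁻ k in B ∩ fermiCurve ε μ, ENNReal.ofReal (‖gradient ε k‖⁻¹) ∂(μH[1] : Measure Momentum) := by
          refine lintegral_mono_ae ?_
          filter_upwards [ae_restrict_mem (hBm.inter hFm)] with k hk
          exact hdens k hk.2
  refine lt_of_lt_of_le ?_ hlow
  have hlen : ENNReal.ofReal (π / 4) ≤ μH[1] (B ∩ fermiCurve ε μ) := by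
    rw [inter_comm]; exact kltp_m03_arc_length hμ1 (by linarith)
  have h5 : (0 : ℝ≥0∞) < ENNReal.ofReal (1 / 5) := ENNReal.ofReal_pos.2 (by norm_num)
  have h4 : (0 : ℝ≥0∞) < ENNReal.ofReal (π / 4) := ENNReal.ofReal_pos.2 (by positivity)
  exact lt_of_lt_of_le (ENNReal.mul_pos h5.ne' h4.ne') (mul_le_mul' le_rfl hlen)

/-! ### §3 Channel states exist in every channel -/

/-- A continuous bounded function that vanishes nowhere on the box has positive square integral against `σ[ε_{−0.3}, μ]`, `μ ∈ (−6/5, −4/5]`. [folklore] -/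
theorem kltp_m03_sq_integral_pos {μ : ℝ} (hμ1 : -6 / 5 < μ) (hμ2 : μ ≤ -4 / 5) {φ : Momentum → ℝ} (hφ : Continuous φ)
    {C : ℝ} (hC : ∀ k, |φ k| ≤ C)
    (hne : ∀ k : Momentum, k 0 ∈ Icc (π / 2) (3 * π / 4) → k 1 ∈ Ioo 0 (π / 2) → φ k ≠ 0) :
    0 < ∫ k, φ k ^ 2 ∂fermiCurveMeasure (squareDispersion 1 (-3 / 10)) μ := by
  set σ := fermiCurveMeasure (squareDispersion 1 (-3 / 10)) μ with hσ
  haveI : IsFiniteMeasure σ :=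
    klph_isFiniteMeasure_tp_of_speedSqFloor' (-3 / 10) μ (w := (μ + 6 / 5) * (26 / 5 - μ)) (by nlinarith)
      (fun k hk => kltp_m03_speedSq_floor ⟨hμ1.le, hμ2⟩ hk)
  have hmeas : AEStronglyMeasurable (fun k => φ k ^ 2) σ := (hφ.pow 2).aestronglyMeasurable
  have hint : Integrable (fun k => φ k ^ 2) σ := by
    refine (MemLp.of_bound hmeas (C ^ 2) (Filter.Eventually.of_forall fun k => ?_)).integrable le_rfl
    rw [Real.norm_eq_abs, abs_pow, ← sq_abs C]
    exact pow_le_pow_left₀ (abs_nonneg _) ((hC k).trans (le_abs_self C)) 2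
  rw [integral_pos_iff_support_of_nonneg (fun k => sq_nonneg (φ k)) hint]
  refine lt_of_lt_of_le (kltp_m03_box_measure_pos hμ1 hμ2) (measure_mono fun k hk => ?_)
  rw [Function.mem_support]
  exact pow_ne_zero 2 (hne k hk.1 hk.2)

/-- **Every symmetry channel has a channel state** on the hole pocket of `ε_{−0.3}`, `μ ∈ (−6/5, −4/5]`: witnesses `1` (`A1g`), `cos k₀ − cos k₁`
(`B1g`), `sin k₀ sin k₁` (`B2g`), `sin k₀ sin k₁ (cos k₀ − cos k₁)` (`A2g`), `sin k₀` (`E`), none of which vanishes on the box. [cite: RaghuKivelsonScalapino2010, §III (17)] -/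
theorem kltp_m03_channelStates_nonempty {μ : ℝ} (hμ1 : -6 / 5 < μ) (hμ2 : μ ≤ -4 / 5) (χ : D4Irrep) :
    {ψ | IsChannelState (squareDispersion 1 (-3 / 10)) μ χ ψ}.Nonempty := by
  have hπ := Real.pi_pos
  haveI : IsFiniteMeasure (fermiCurveMeasure (squareDispersion 1 (-3 / 10)) μ) :=
    klph_isFiniteMeasure_tp_of_speedSqFloor' (-3 / 10) μ (w := (μ + 6 / 5) * (26 / 5 - μ)) (by nlinarith)
      (fun k hk => kltp_m03_speedSq_floor ⟨hμ1.le, hμ2⟩ hk)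
  -- sign facts on the box
  have box : ∀ k : Momentum, k 0 ∈ Icc (π / 2) (3 * π / 4) → k 1 ∈ Ioo 0 (π / 2) →
      0 < sin (k 0) ∧ 0 < sin (k 1) ∧ cos (k 0) - cos (k 1) < 0 := by
    intro k h0 h1
    obtain ⟨hc0, -, hs0⟩ := kltp_arc_trig h0
    have hs1 : 0 < sin (k 1) := sin_pos_of_pos_of_lt_pi h1.1 (by linarith [h1.2])
    have hc1 : 0 < cos (k 1) := cos_pos_of_mem_Ioo ⟨by linarith [h1.1], h1.2⟩
    exact ⟨hs0, hs1, by linarith⟩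
  cases χ with
  | A1g =>
    exact klph_channelStates_nonempty_of_bound_of_pos (φ := fun _ => (1 : ℝ)) continuous_const.aestronglyMeasurable
      (C := 1) (fun _ => by simp) (inChannel_A1g_const 1)
      (kltp_m03_sq_integral_pos hμ1 hμ2 continuous_const (C := 1) (fun _ => by simp) (fun _ _ _ => one_ne_zero))
  | B1g =>
    have hcont : Continuous fun k : Momentum => cos (k 0) - cos (k 1) := by fun_prop
    have hbd : ∀ k : Momentum, |cos (k 0) - cos (k 1)| ≤ 2 := fun k => by
      have h1 := abs_cos_le_one (k 0); have h2 := abs_cos_le_one (k 1)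
      calc |cos (k 0) - cos (k 1)| ≤ |cos (k 0)| + |cos (k 1)| := abs_sub _ _
        _ ≤ 2 := by linarith
    exact klph_channelStates_nonempty_of_bound_of_pos hcont.aestronglyMeasurable hbd inChannel_B1g_harmonic
      (kltp_m03_sq_integral_pos hμ1 hμ2 hcont hbd fun k h0 h1 => (box k h0 h1).2.2.ne)
  | B2g =>
    have hcont : Continuous fun k : Momentum => sin (k 0) * sin (k 1) := by fun_prop
    have hbd : ∀ k : Momentum, |sin (k 0) * sin (k 1)| ≤ 1 := fun k => by
      rw [abs_mul]
      have h1 := abs_sin_le_one (k 0); have h2 := abs_sin_le_one (k 1)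
      nlinarith [abs_nonneg (sin (k 0)), abs_nonneg (sin (k 1))]
    exact klph_channelStates_nonempty_of_bound_of_pos hcont.aestronglyMeasurable hbd inChannel_B2g_harmonic
      (kltp_m03_sq_integral_pos hμ1 hμ2 hcont hbd fun k h0 h1 =>
        (mul_pos (box k h0 h1).1 (box k h0 h1).2.1).ne')
  | A2g =>
    have hcont : Continuous fun k : Momentum => sin (k 0) * sin (k 1) * (cos (k 0) - cos (k 1)) := by fun_prop
    have hbd : ∀ k : Momentum, |sin (k 0) * sin (k 1) * (cos (k 0) - cos (k 1))| ≤ 2 := fun k => by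
      rw [abs_mul, abs_mul]
      have h1 := abs_sin_le_one (k 0); have h2 := abs_sin_le_one (k 1)
      have h3 : |cos (k 0) - cos (k 1)| ≤ 2 := by
        have h1 := abs_cos_le_one (k 0); have h2 := abs_cos_le_one (k 1)
        calc |cos (k 0) - cos (k 1)| ≤ |cos (k 0)| + |cos (k 1)| := abs_sub _ _
          _ ≤ 2 := by linarith
      have h12 : |sin (k 0)| * |sin (k 1)| ≤ 1 := by nlinarith [abs_nonneg (sin (k 0)), abs_nonneg (sin (k 1))]
      nlinarith [abs_nonneg (sin (k 0)), abs_nonneg (sin (k 1)), abs_nonneg (cos (k 0) - cos (k 1)),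
        mul_nonneg (abs_nonneg (sin (k 0))) (abs_nonneg (sin (k 1)))]
    exact klph_channelStates_nonempty_of_bound_of_pos hcont.aestronglyMeasurable hbd inChannel_A2g_harmonic
      (kltp_m03_sq_integral_pos hμ1 hμ2 hcont hbd fun k h0 h1 => by
        have hb := box k h0 h1
        exact (mul_neg_of_pos_of_neg (mul_pos hb.1 hb.2.1) hb.2.2).ne)
  | E =>
    have hcont : Continuous fun k : Momentum => sin (k 0) := by fun_prop
    exact klph_channelStates_nonempty_of_bound_of_pos hcont.aestronglyMeasurable (fun k => abs_sin_le_one (k 0))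
      inChannel_E_harmonic (kltp_m03_sq_integral_pos hμ1 hμ2 hcont (fun k => abs_sin_le_one (k 0))
        fun k h0 h1 => (box k h0 h1).1.ne')

/-! ### §4 `KLTPAnalytic` from the `χ₀` sup bound alone, and the cell corollaries modulo (E2) + (E4) -/

/-- **The analytic facts at `(ε_{−0.3}, μ)`, `μ ∈ (−6/5, −4/5]`, from a `χ₀` sup bound ALONE**: finiteness of `σ` from the sharp speed floor
(`kltp_m03_speedSq_floor`, p722895), the `D₄` rows (theorems), the Hilbert–Schmidt property from the bound, and channel states from §3.
[cite: RaghuKivelsonScalapino2010, §II (5)-(8) and §III (17)] -/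
theorem kltp_m03_analytic_of_chi0Sup {μ : ℝ} (hμ1 : -6 / 5 < μ) (hμ2 : μ ≤ -4 / 5) {C : ℝ}
    (hC : ∀ k ∈ fermiCurve (squareDispersion 1 (-3 / 10)) μ, ∀ k' ∈ fermiCurve (squareDispersion 1 (-3 / 10)) μ,
      |lindhardFunction (squareDispersion 1 (-3 / 10)) μ (k + k')| ≤ C) :
    KLTPAnalytic (squareDispersion 1 (-3 / 10)) μ := by
  haveI hfin : IsFiniteMeasure (fermiCurveMeasure (squareDispersion 1 (-3 / 10)) μ) :=
    klph_isFiniteMeasure_tp_of_speedSqFloor' (-3 / 10) μ (w := (μ + 6 / 5) * (26 / 5 - μ)) (by nlinarith)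
      (fun k hk => kltp_m03_speedSq_floor ⟨hμ1.le, hμ2⟩ hk)
  exact klTPAnalytic_of (-3 / 10) μ hfin (klph_memLp_kernel_of_bound (measurable_squareDispersion 1 (-3 / 10)) μ hC)
    (kltp_m03_channelStates_nonempty hμ1 hμ2)

/-- The record's box lies in `(−6/5, −4/5]`. [folklore] -/
theorem klCertB1gTPm03D0125_box_mem :
    ∀ bx ∈ klCertB1gTPm03D0125.boxes, ∀ μ ∈ Set.Icc (bx.mulo : ℝ) (bx.muhi : ℝ), -6 / 5 < μ ∧ μ ≤ -4 / 5 := by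
  intro bx hbx μ hμ
  have hbox : bx.mulo = (-4321685426123455 : ℚ) / 4503599627370496 ∧ bx.muhi = (-8643302132770191 : ℚ) / 9007199254740992 := by
    simp only [klCertB1gTPm03D0125, List.mem_singleton] at hbx
    subst hbx
    exact ⟨rfl, rfl⟩
  obtain ⟨hlo, hhi⟩ := hμ
  rw [hbox.1] at hlo
  rw [hbox.2] at hhi
  push_cast at hlo hhi
  exact ⟨by linarith, by linarith⟩

/-- **The `(⅛, −0.3)` record's weak-coupling dominance MODULO (E2) and (E4) only**: if, for every `μ` of the record's box,
(E2) `|χ₀[ε_{−0.3}](k + k′)| ≤ 53/100` on `F × F` and (E4) the enclosures `EnclosuresB1gTP (-3/10)` hold, then `KLB1gDominatesTP (-3/10) mub mua gamma`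
— (E1) and (E3) of p714676 are now theorems. [cite: RaghuKivelsonScalapino2010, §II (5)-(8) and §III Fig. 3] -/
theorem klCertB1gTPm03D0125_dominates_of_chi0Sup
    (hC : ∀ bx ∈ klCertB1gTPm03D0125.boxes, ∀ μ ∈ Set.Icc (bx.mulo : ℝ) (bx.muhi : ℝ),
      ∀ k ∈ fermiCurve (squareDispersion 1 (-3 / 10)) μ, ∀ k' ∈ fermiCurve (squareDispersion 1 (-3 / 10)) μ,
        |lindhardFunction (squareDispersion 1 (-3 / 10)) μ (k + k')| ≤ 53 / 100)
    (hE : klCertB1gTPm03D0125.EnclosuresB1gTP (-3 / 10)) :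
    KLB1gDominatesTP (-3 / 10) ((klCertB1gTPm03D0125.mub : ℚ) : ℝ) ((klCertB1gTPm03D0125.mua : ℚ) : ℝ)
      ((klCertB1gTPm03D0125.gamma : ℚ) : ℝ) :=
  kltp_window_U (-3 / 10) klCertB1gTPm03D0125 klCertB1gTPm03D0125_check
    (fun bx hbx μ hμ =>
      kltp_m03_analytic_of_chi0Sup (klCertB1gTPm03D0125_box_mem bx hbx μ hμ).1 (klCertB1gTPm03D0125_box_mem bx hbx μ hμ).2
        (hC bx hbx μ hμ))
    hE

/-- The `U = 1` form MODULO (E2) and (E4) only: `KLB1gDominatesAtTP (-3/10) mub mua gamma`. [cite: RaghuKivelsonScalapino2010, §III Fig. 3] -/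
theorem klCertB1gTPm03D0125_dominatesAt_of_chi0Sup
    (hC : ∀ bx ∈ klCertB1gTPm03D0125.boxes, ∀ μ ∈ Set.Icc (bx.mulo : ℝ) (bx.muhi : ℝ),
      ∀ k ∈ fermiCurve (squareDispersion 1 (-3 / 10)) μ, ∀ k' ∈ fermiCurve (squareDispersion 1 (-3 / 10)) μ,
        |lindhardFunction (squareDispersion 1 (-3 / 10)) μ (k + k')| ≤ 53 / 100)
    (hE : klCertB1gTPm03D0125.EnclosuresB1gTP (-3 / 10)) :
    KLB1gDominatesAtTP (-3 / 10) ((klCertB1gTPm03D0125.mub : ℚ) : ℝ) ((klCertB1gTPm03D0125.mua : ℚ) : ℝ)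
      ((klCertB1gTPm03D0125.gamma : ℚ) : ℝ) :=
  kltp_window (-3 / 10) klCertB1gTPm03D0125 klCertB1gTPm03D0125_check
    (fun bx hbx μ hμ =>
      kltp_m03_analytic_of_chi0Sup (klCertB1gTPm03D0125_box_mem bx hbx μ hμ).1 (klCertB1gTPm03D0125_box_mem bx hbx μ hμ).2
        (hC bx hbx μ hμ))
    hE

end Summit.HubbardSuperconductivity.HubbardSuperconductivity.Theorems

end
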